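import Mathlib
import Literature.AlgebraicGeometry.Tropical.InitialIdeal
import Literature.AlgebraicGeometry.Tropical.TropicalLink
import Summits.ResolutionOfSingularities.ResolutionOfSingularities.Theorems.TropicalLinksInductiveStepWeightZero
import Summits.ResolutionOfSingularities.ResolutionOfSingularities.Theorems.TropicalLinksInductiveStepWeightSplitting
import Summits.ResolutionOfSingularities.ResolutionOfSingularities.Theorems.TropicalLinksInductiveStepLaurentRegular
import Summits.ResolutionOfSingularities.ResolutionOfSingularities.Theorems.TropicalLinksInductiveStepLaurentRegularPi

/-!
# TropicalLinks / InductiveStep — the Laurent ring on the kernel lattice of a nonzero weight is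
# regular iff the base is (brick C2)

Route `ResolutionOfSingularities/TropicalLinks`, crux `InductiveStep`
(stmt-ResolutionOfSingularities-17233), line `split`, in support of stub `stub_sncClosureSchon`.

The roadmap for `stub_sncClosureSchon` (Luxton–Qu) computes the special fibre of the toric partial
compactification along a weighted ray `b` through an snc stratum as the Laurent ring
`(A ⧸ (m))[K_b]` on the kernel lattice `K_b := ker ⟨b, ·⟩ ≤ ℤ^l` (brick C1). To conclude that this
fibre is regular one needs:

* `tropicalLinks_forall_prime_regular_laurent_ker_iff` (registered brick C2) — for a Noetherian ring
  `A` and a nonzero weight `b ∈ ℤ^l`, every prime localization of `A[K_b] = AddMonoidAlgebra A K_b`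
  is regular iff the same holds for `A`.

Proof sketch: write `⟨b, ·⟩ = ℓ · ⟨w₀, ·⟩` with `ℓ > 0` and `w₀` primitive (brick B6,
`tropicalLinks_exists_pos_mul_primitive_dotWeight`), so that `K_b = K := ker ⟨w₀, ·⟩`
(`tropicalLinks_ker_dotWeightHom_eq_of_mul`) and `ℤ^l ≃+ ℤ × K`
(`tropicalLinks_exists_addEquiv_prod_ker`). Hence `A[K_b] ≃+* A[K]` and
`A[ℤ^l] ≃+* A[ℤ × K] ≃+* (A[K])[ℤ]` (`AddMonoidAlgebra.domCongr`, `AddMonoidAlgebra.curryRingEquiv`),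
and the chain
`A[K_b] regular ⟺ A[K] regular ⟺ (A[K])[ℤ] regular ⟺ A[ℤ^l] regular ⟺ A regular`
follows from the one-variable brick B7 (`tropicalLinks_forall_prime_regular_laurent_iff`), the
several-variables brick B7m (`tropicalLinks_forall_prime_regular_laurent_pi_iff`) and transport of
regularity at all primes along ring isomorphisms
(`tropicalLinks_forall_prime_regular_of_ringEquiv`). No new definitions.
-/

set_option linter.dupNamespace false -- single-conjunct summit: doubled namespace component is mandated

namespace Summit.ResolutionOfSingularities.ResolutionOfSingularities.Theorems

open AddMonoidAlgebra Literature.AlgebraicGeometry.Tropical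

/-- **Proportional weights have the same kernel lattice**: if `ℓ ≠ 0` and `ℓ · ⟨w₀, v⟩ = ⟨b, v⟩` for
all `v ∈ ℤ^l`, then `ker ⟨b, ·⟩ = ker ⟨w₀, ·⟩` as subgroups of `ℤ^l`. [folklore] -/
theorem tropicalLinks_ker_dotWeightHom_eq_of_mul {l : ℕ} {b w₀ : Fin l → ℤ} {ℓ : ℤ} (hℓ : ℓ ≠ 0)
    (h : ∀ v, ℓ * dotWeight w₀ v = dotWeight b v) :
    (dotWeightHom b).ker = (dotWeightHom w₀).ker := by
  ext v
  simp only [AddMonoidHom.mem_ker, coe_dotWeightHom, ← h v, mul_eq_zero, hℓ, false_or]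

/-- **Brick C2 — the Laurent ring on the kernel lattice of a nonzero weight is regular iff the base
is**: for a Noetherian commutative ring `A`, `l : ℕ` and a nonzero weight `b ∈ ℤ^l`, every
localization at a prime of `A[K_b] = AddMonoidAlgebra A (ker ⟨b, ·⟩)` is a regular local ring iff
every localization of `A` at a prime is (`K_b ≅ ℤ^{l-1}` non-canonically: `ℤ^l ≃+ ℤ × K_b` after
replacing `b` by the primitive weight `w₀` it is a positive multiple of, whence
`A[ℤ^l] ≃+* (A[K_b])[ℤ]`, and bricks B7, B7m apply). [folklore] -/
theorem tropicalLinks_forall_prime_regular_laurent_ker_iff : ∀ (A : Type) [CommRing A] (l : ℕ) (b : Fin l → ℤ), b ≠ 0 → IsNoetherianRing A → ((∀ (P : Ideal (AddMonoidAlgebra A ↥(AddMonoidHom.ker (Literature.AlgebraicGeometry.Tropical.dotWeightHom b)))) [P.IsPrime], IsRegularLocalRing (Localization.AtPrime P)) ↔ ∀ (P : Ideal A) [P.IsPrime], IsRegularLocalRing (Localization.AtPrime P)) := by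
  intro A _ l b hb hA
  -- `⟨b, ·⟩ = ℓ · ⟨w₀, ·⟩` with `ℓ > 0` and `⟨w₀, v₀⟩ = 1`
  obtain ⟨ℓ, w₀, v₀, hℓ, hscale, hv₀⟩ := tropicalLinks_exists_pos_mul_primitive_dotWeight hb
  -- the splitting `ℤ^l ≃+ ℤ × K`, `K := ker ⟨w₀, ·⟩`
  obtain ⟨e, -⟩ := tropicalLinks_exists_addEquiv_prod_ker (dotWeightHom w₀) v₀ hv₀
  -- `K_b = K`, hence `A[K_b] ≃+* A[K]`
  have hker : (dotWeightHom b).ker = (dotWeightHom w₀).ker :=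
    tropicalLinks_ker_dotWeightHom_eq_of_mul hℓ.ne' hscale
  have E₁ : AddMonoidAlgebra A (dotWeightHom b).ker ≃+* AddMonoidAlgebra A (dotWeightHom w₀).ker :=
    (AddMonoidAlgebra.domCongr A A (AddEquiv.addSubgroupCongr hker)).toRingEquiv
  -- `A[ℤ^l] ≃+* A[ℤ × K] ≃+* (A[K])[ℤ]`
  have E₂ : AddMonoidAlgebra A (Fin l → ℤ) ≃+*
      AddMonoidAlgebra (AddMonoidAlgebra A (dotWeightHom w₀).ker) ℤ :=
    (AddMonoidAlgebra.domCongr A A e).toRingEquiv.trans AddMonoidAlgebra.curryRingEquiv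
  -- Noetherianity of `(A[K])[ℤ]` through `E₂`
  haveI : IsNoetherianRing (AddMonoidAlgebra A (Fin l → ℤ)) :=
    Algebra.FiniteType.isNoetherianRing A _
  have hN : IsNoetherianRing (AddMonoidAlgebra (AddMonoidAlgebra A (dotWeightHom w₀).ker) ℤ) :=
    isNoetherianRing_of_ringEquiv _ E₂
  calc (∀ (P : Ideal (AddMonoidAlgebra A (dotWeightHom b).ker)) [P.IsPrime],
          IsRegularLocalRing (Localization.AtPrime P))
      ↔ ∀ (P : Ideal (AddMonoidAlgebra A (dotWeightHom w₀).ker)) [P.IsPrime],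
          IsRegularLocalRing (Localization.AtPrime P) :=
        ⟨fun h => tropicalLinks_forall_prime_regular_of_ringEquiv E₁ h,
          fun h => tropicalLinks_forall_prime_regular_of_ringEquiv E₁.symm h⟩
    _ ↔ ∀ (P : Ideal (AddMonoidAlgebra (AddMonoidAlgebra A (dotWeightHom w₀).ker) ℤ)) [P.IsPrime],
          IsRegularLocalRing (Localization.AtPrime P) :=
        (tropicalLinks_forall_prime_regular_laurent_iff _ hN).symm
    _ ↔ ∀ (P : Ideal (AddMonoidAlgebra A (Fin l → ℤ))) [P.IsPrime],
          IsRegularLocalRing (Localization.AtPrime P) :=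
        ⟨fun h => tropicalLinks_forall_prime_regular_of_ringEquiv E₂.symm h,
          fun h => tropicalLinks_forall_prime_regular_of_ringEquiv E₂ h⟩
    _ ↔ ∀ (P : Ideal A) [P.IsPrime], IsRegularLocalRing (Localization.AtPrime P) :=
        tropicalLinks_forall_prime_regular_laurent_pi_iff A l hA

end Summit.ResolutionOfSingularities.ResolutionOfSingularities.Theorems
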